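import Summits.AtomisticToContinuum.Crystallization.Theses.PhononSlackCertificates
import Summits.AtomisticToContinuum.Crystallization.Theses.NashClassCertificates
import Summits.AtomisticToContinuum.Crystallization.Theses.SpectralChargeLedger

/-!
# Disproof work file — crux `PeriodicGivenLayered` (stmt-AtomisticToContinuum-11779)

Refuter seat `refuter-cdisprove-stmt-AtomisticToContinuum-11779-0`, cycle 1 (2026-08-16).

TWIN CRUX stmt-AtomisticToContinuum-17658 (`NashClassCertificates.PeriodicGivenLayered` =
`SpectralChargeLedger.PeriodicGivenLayered`, the same statement character for character): refuter seat
`refuter-cdisprove-stmt-AtomisticToContinuum-17658-0`, cycle 1 (2026-08-17) — see the LAST section of this file: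
the statement is PROVED in tree (`LayeredHull.PeriodicGivenLayered_of`, 2026-08-16; both twin copies closed by
`Theorems.NashPeriodicGivenLayered.periodicGivenLayered_proof`, p157733, 2026-08-17T11:34Z, axioms standard), so no
`¬ PeriodicGivenLayered` exists; that section records the twin bridges (`Iff.rfl`), how the landed proof prices each
witness family of the load-bearing map (a)/(a′)/(a″) below, and the nil attacks of the cycle.

## Findings (index)

* The crux as stated quantifies over sequences of genuine Lennard-Jones ground states; neither its
  hypothesis (layered windows) nor its conclusion (periodic windows) can be decided for actual
  ground states with present knowledge, so an unconditional `¬ PeriodicGivenLayered` is out of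
  reach (it would need: LJ ground states ARE layered at all scales AND are NOT periodic-windowed —
  kill criterion (iv) of the route, an aperiodic optimal stacking).  Junk checks: the conclusion is
  not vacuous (`PeriodicConfiguration.motif_nonempty`, full-rank lattice), the hypothesis is
  honest (genuine `IsHaggSeq`, spacings boxed, `A` a linear isometry), compactness of
  `O(3) × [47/50,1]` absorbs per-window rotations/scales, `∃ᶠ N` absorbs parity-type alternation.
* LANDED IN THE TREE (importable): `Summits.AtomisticToContinuum.Crystallization.Theorems.PeriodicGivenLayered.Negative.SpacingFreedom`
  (p99409, accepted 2026-08-16: (a), (a′), `HasLayeredWindows`/`HasPeriodicWindows`/`PeriodicGivenLayeredFor`,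
  lattice lemma `exists_mem_lattice_apply_two_ne_zero`); `…Negative.StackingFreedom` ((a″)) proposed next.
* (a) LOAD-BEARING ANALYSIS, landed as theorems below:
  `periodicGivenLayered_false_without_groundState` — with the ground-state hypothesis dropped the
  implication LAYERED WINDOWS ⇒ PERIODIC WINDOWS is FALSE.  Witness: the enumerated layered set with
  constant (fcc, `constHagg`) registry, `a = 1`, and QUASI-PERIODIC interlayer heights
  `z m = 41/50·m + 3/100·fract(m √2)` (increments `0.8024…`, `0.8324…`, inside the box
  `[39/50, 17/20]`).  It has layered windows at every scale (it IS an admissible layered set), but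
  no periodic configuration is two-way matched on all balls: a period `g` with `g₃ ≠ 0` (exists by
  full rank) forces, inside one window, an `M`-term chain of layer heights with constant difference
  `g₃ ± 2ε`; the layer-index step is pinned to `k = round(g₃/(41/50))`, the fractional increments
  `fract((m+k)√2) - fract(m√2) ∈ {β, β-1}`, `β = fract(k√2) ∈ (0,1)` by irrationality, must all be
  equal and telescope to a number in `(-1,1)`, impossible for `M > 1/β, 1/(1-β)`.
  MESSAGE TO PROVERS: the free interlayer spacings `z` of the `LayeredWindows` format must be
  pinned (asymptotically constant) by an ENERGY argument before any periodic `P` can exist; the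
  stacking word is a second, independent freedom (see (a″)).
* (a′) `not_periodicGivenLayeredFor_zero` — the same witness is a sequence of ground states of the
  ZERO potential, so `PeriodicGivenLayeredFor V` admits no potential-uniform proof
  (`PeriodicGivenLayeredFor lennardJones ↔ PeriodicGivenLayered` is `Iff.rfl`).
* (a″) `periodicGivenLayered_false_without_groundState_constSpacing` — STACKING FREEDOM: even with
  `a = 1`, `A = id` and CONSTANT interlayer spacing `4/5` the free Hägg word defeats periodic windows
  without energetics (Sturmian word of slope `√2 − 1`: balanced, aperiodic, syndetic faults — kill
  criterion (iv) made concrete minus the energetics); `HasConstSpacingLayeredWindows.hasLayeredWindows`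
  and `periodicGivenConstSpacing_of_without` relate it to (a).  PROVED below (rc 0, no sorry).
  MESSAGE: zero fault density / Hägg domination is load-bearing, pinning the spacings is not enough.
* LOAD-BEARING MAP of the hypothesis format `∃ a ∀ R ε ∃ᶠ N ∃ A t s z`: the per-window freedoms
  `A` (frame) and `t` (translation) are HARMLESS (compactness of `O(3)`, translation built into the
  conclusion); the freedoms `z` (spacings, (a)) and `s` (Hägg word, (a″)) are each FATAL without
  energetics; so the ground-state hypothesis must enter exactly to pin `z` and to control `s`.
* Literature on kill criterion (iv) (aperiodic optimal LJ stacking): Pártay–Ortner–Bartók–Pickard–Csányi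
  2017 (arXiv:1705.01751, p. 5): among 19 periodic polytypes hcp is the most favourable stacking at low
  pressure for every cutoff; non-hcp/fcc polytypes (⟨hc⟩, ⟨hhc⟩, …) win only near the fcc–hcp boundary
  at elevated pressure / special truncations — no zero-pressure aperiodic or long-period competitor is
  on record (consistent with the route's Hägg-domination margin 287); Loach–Ackland 2017
  (arXiv:1708.01460, PRL 119, 205701, p. 4): for untruncated LJ at zero pressure the ANNNI-type layer
  couplings converge to `H2 ≈ −0.0009ε` with `H3` two orders smaller, "indicating a stable hcp ground
  state" — again no aperiodic competitor.  `lit search` (searchd) was unavailable (rc 75) this session;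
  only these two papers were read (materialised by DOI).
* Line `Sketch` (lead prover-line-…-11779-0; stubs RegistrySignAntitone, PerFaultGainFreeSpacings,
  WindowSiteEnergyBound, IncrementConvexity): cheap numerics (pure-python direct lattice sums
  cross-checked against Poisson/Bessel summation, this seat, folder `num/coupling.py`) reproduce
  the card's registry coupling `D_a(H) = Φ_A − Φ_N` for LJ: `D_1(1.7) = −3.684e-5`,
  `D_1(2.34) = −1.77e-7` (per-fault margin `3.67e-5 > 3e-5` at the worst corner `a = 1`;
  `a = 0.94` gives `4.78e-5`), `D ≤ 0` and increasing on `H/a ∈ [1.56, 2.48]` for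
  `a ∈ {0.94, 1}` — no stub is cheaply false; `WindowSiteEnergyBound` is the standard one-sided
  cut-and-paste with FULL site energies (`siteEnergy` has no ½), consistent.  Broader scan
  (`num/scan.py`): `D_a(H) ≤ 0` and non-decreasing on `H/a ∈ [1.56, 3.0]` (step 0.04) for
  `a ∈ {0.94, 0.97, 1}`; per-fault margin `min = 3.666e-5` at `a = 1`; IncrementConvexity inputs
  `min Φ_N'' = 6.51` (a = 1), `23.7` (a = 0.94) on the spacing box against `Σ_{k≥2} k² sup|Φ_k''| = 2.09`
  (a = 1), `3.33` (a = 0.94) — diagonal dominance margin `≥ 3.1`, as the card claims (uncertified floats).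
-/

noncomputable section

namespace Summit.AtomisticToContinuum.Crystallization.Cruxes.PeriodicGivenLayered.Disproof

open scoped BigOperators
open Filter Set Literature.MathematicalPhysics.StatisticalMechanics

local notation "E3" => EuclideanSpace ℝ (Fin 3)

/-! ## The two sides of the crux, named -/

/-- LAYERED WINDOWS of a sequence of finite configurations — the hypothesis of the crux, verbatim
(the statement of `LayeredWindows`, stmt-11778, for the given sequence). -/
def HasLayeredWindows (x : (N : ℕ) → (Fin N → E3)) : Prop :=
  ∃ a : ℝ, 47 / 50 ≤ a ∧ a ≤ 1 ∧ ∀ R ε : ℝ, 0 < ε → ∃ᶠ N in Filter.atTop,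
    ∃ (A : EuclideanSpace ℝ (Fin 3) →ₗᵢ[ℝ] EuclideanSpace ℝ (Fin 3)) (t : EuclideanSpace ℝ (Fin 3))
      (s : ℤ → ℤ) (z : ℤ → ℝ), IsHaggSeq s ∧
      (∀ m : ℤ, 39 / 50 * a ≤ z (m + 1) - z m ∧ z (m + 1) - z m ≤ 17 / 20 * a) ∧
      let S : Set (EuclideanSpace ℝ (Fin 3)) := {p | ∃ m i j : ℤ, p = A (((i : ℝ) • triangularVec₁ a) +
        ((j : ℝ) • triangularVec₂ a) + ((haggLabel s m : ℝ) • barlowOffset a) + (z m • layerNormal 1))};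
      (∀ p ∈ S, ‖p‖ ≤ R → ∃ i : Fin N, dist (x N i + t) p ≤ ε) ∧
      (∀ i : Fin N, ‖x N i + t‖ ≤ R → ∃ p ∈ S, dist (x N i + t) p ≤ ε)

/-- PERIODIC WINDOWS of a sequence of finite configurations — the conclusion of the crux, verbatim
(the statement of `PeriodicWindows`, stmt-3240, for the given sequence). -/
def HasPeriodicWindows (x : (N : ℕ) → (Fin N → E3)) : Prop :=
  ∃ P : PeriodicConfiguration 3, ∀ R ε : ℝ, 0 < ε → ∃ᶠ N in Filter.atTop,
    ∃ t : EuclideanSpace ℝ (Fin 3),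
      (∀ s ∈ P.points, ‖s‖ ≤ R → ∃ i : Fin N, dist (x N i + t) s ≤ ε) ∧
      (∀ i : Fin N, ‖x N i + t‖ ≤ R → ∃ s ∈ P.points, dist (x N i + t) s ≤ ε)

/-- The crux parametrised by the pair potential. -/
def PeriodicGivenLayeredFor (V : ℝ → ℝ) : Prop :=
  ∀ x : (N : ℕ) → (Fin N → E3), (∀ N, IsGroundState V (x N)) →
    HasLayeredWindows x → HasPeriodicWindows x

/-- At `V = lennardJones` this is literally the crux. -/
theorem periodicGivenLayeredFor_lennardJones_iff :
    PeriodicGivenLayeredFor lennardJones ↔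
      Summit.AtomisticToContinuum.Crystallization.Theses.PhononSlackCertificates.PeriodicGivenLayered :=
  Iff.rfl

/-- The crux WITHOUT the ground-state hypothesis: layered windows ⇒ periodic windows for EVERY
sequence of finite configurations. -/
def PeriodicGivenLayeredWithoutGroundState : Prop :=
  ∀ x : (N : ℕ) → (Fin N → E3), HasLayeredWindows x → HasPeriodicWindows x

/-- The dropped-hypothesis form implies the crux (so its failure is informative, not fatal). -/
theorem periodicGivenLayered_of_without (h : PeriodicGivenLayeredWithoutGroundState) :
    Summit.AtomisticToContinuum.Crystallization.Theses.PhononSlackCertificates.PeriodicGivenLayered :=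
  fun x _ hx => h x hx

/-! ## The witness: fcc registry, quasi-periodic heights -/

/-- Quasi-periodic layer heights `z m = 41/50·m + 3/100·fract(m √2)`. -/
def qpHeight (m : ℤ) : ℝ := 41 / 50 * m + 3 / 100 * Int.fract ((m : ℝ) * √2)

theorem qpHeight_sub (m m' : ℤ) :
    qpHeight m' - qpHeight m =
      41 / 50 * ((m' - m : ℤ) : ℝ) + 3 / 100 * (Int.fract ((m' : ℝ) * √2) - Int.fract ((m : ℝ) * √2)) := by
  unfold qpHeight; push_cast; ring

/-- The increments lie in the admissible box `[39/50, 17/20]` (for `a = 1`). -/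
theorem qpHeight_spacing (m : ℤ) :
    39 / 50 * (1 : ℝ) ≤ qpHeight (m + 1) - qpHeight m ∧ qpHeight (m + 1) - qpHeight m ≤ 17 / 20 * (1 : ℝ) := by
  have h := qpHeight_sub m (m + 1)
  have h0 := Int.fract_nonneg (((m + 1 : ℤ) : ℝ) * √2)
  have h1 := Int.fract_lt_one (((m + 1 : ℤ) : ℝ) * √2)
  have h2 := Int.fract_nonneg ((m : ℝ) * √2)
  have h3 := Int.fract_lt_one ((m : ℝ) * √2)
  simp only [add_sub_cancel_left, Int.cast_one] at h
  constructor <;> linarith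

theorem qpHeight_strictMono : StrictMono qpHeight :=
  strictMono_int_of_lt_succ fun m => by have := (qpHeight_spacing m).1; linarith

/-- `fract (x + y) - fract x ∈ {fract y, fract y - 1}`. -/
theorem fract_add_sub_fract (x y : ℝ) :
    Int.fract (x + y) - Int.fract x = Int.fract y ∨ Int.fract (x + y) - Int.fract x = Int.fract y - 1 := by
  obtain ⟨e, he⟩ := Int.fract_add x y
  have h0 := Int.fract_nonneg (x + y)
  have h1 := Int.fract_lt_one (x + y)
  have h2 := Int.fract_nonneg x
  have h3 := Int.fract_lt_one x
  have h4 := Int.fract_nonneg y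
  have h5 := Int.fract_lt_one y
  have he1 : (e : ℝ) < 1 := by linarith
  have he2 : (-2 : ℝ) < e := by linarith
  have : e = 0 ∨ e = -1 := by
    have := (show e < 1 by exact_mod_cast he1); have := (show -2 < e by exact_mod_cast he2); omega
  rcases this with rfl | rfl
  · left; push_cast at he; linarith
  · right; push_cast at he; linarith

/-- ROUNDING: a height difference within `2ε ≤ 1/200` of `γ` pins the layer-index step to
`round (γ / (41/50))`. -/
theorem step_eq_round {γ ε : ℝ} (hε : ε ≤ 1 / 400) {m m' : ℤ}
    (h : |qpHeight m' - qpHeight m - γ| ≤ 2 * ε) : m' - m = round (γ / (41 / 50)) := by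
  have hsub := qpHeight_sub m m'
  have hρb : |γ / (41 / 50) - round (γ / (41 / 50))| ≤ 1 / 2 := abs_sub_round _
  set ρ : ℤ := round (γ / (41 / 50)) with hρ
  set k : ℤ := m' - m with hk
  have hf1 := Int.fract_nonneg ((m' : ℝ) * √2)
  have hf2 := Int.fract_lt_one ((m' : ℝ) * √2)
  have hf3 := Int.fract_nonneg ((m : ℝ) * √2)
  have hf4 := Int.fract_lt_one ((m : ℝ) * √2)
  have e : γ / (41 / 50) = 50 / 41 * γ := by ring
  rw [e] at hρb
  rw [abs_le] at h hρb
  have hlt : |(k : ℝ) - ρ| < 1 := by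
    rw [abs_lt]; constructor <;> nlinarith [h.1, h.2, hρb.1, hρb.2]
  rw [abs_lt] at hlt
  have h5 : k - ρ < 1 := by exact_mod_cast (show ((k : ℝ) - ρ) < 1 from hlt.2)
  have h6 : -1 < k - ρ := by exact_mod_cast (show (-1 : ℝ) < (k : ℝ) - ρ from hlt.1)
  omega

/-- NUMBER THEORY CORE: no non-zero real `γ` admits, for every `M` and `ε > 0`, a chain of `M + 1`
quasi-periodic heights with consecutive differences within `2ε` of `γ`. -/
theorem no_height_chain {γ : ℝ} (hγ : γ ≠ 0)
    (chain : ∀ (M : ℕ) (ε : ℝ), 0 < ε →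
      ∃ m : ℕ → ℤ, ∀ n < M, |qpHeight (m (n + 1)) - qpHeight (m n) - γ| ≤ 2 * ε) : False := by
  set r : ℤ := round (γ / (41 / 50)) with hr
  by_cases hr0 : r = 0
  · -- step 0: consecutive heights coincide, so |γ| ≤ 2ε
    have hγpos : 0 < |γ| := abs_pos.2 hγ
    obtain ⟨m, hm⟩ := chain 1 (min (1 / 400) (|γ| / 8)) (lt_min (by norm_num) (by positivity))
    have h := hm 0 zero_lt_one
    have hk := step_eq_round (min_le_left _ _) h
    rw [← hr, hr0] at hk
    have h01 : m (0 + 1) = m 0 := by omega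
    rw [h01, sub_self, zero_sub, abs_neg] at h
    have : |γ| ≤ |γ| / 4 := h.trans (by linarith [min_le_right (1 / 400 : ℝ) (|γ| / 8)])
    linarith
  · -- step r ≠ 0: the fractional increments are all `β` or all `β - 1`
    set β : ℝ := Int.fract ((r : ℝ) * √2) with hβ
    have hβ0 : 0 < β := by
      rcases (Int.fract_nonneg ((r : ℝ) * √2)).lt_or_eq with h | h
      · exact h
      · exfalso
        have hirr : Irrational ((r : ℝ) * √2) := irrational_sqrt_two.intCast_mul hr0
        apply hirr.ne_int ⌊(r : ℝ) * √2⌋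
        have := Int.fract_add_floor ((r : ℝ) * √2)
        rw [← hβ] at this; rw [← hβ] at h
        linarith
    have hβ1 : β < 1 := Int.fract_lt_one _
    obtain ⟨M, hM⟩ := exists_nat_gt (max (1 / β) (1 / (1 - β)))
    have hM1 : 1 / β < M := (le_max_left _ _).trans_lt hM
    have hM2 : 1 / (1 - β) < M := (le_max_right _ _).trans_lt hM
    have hMβ : 1 < (M : ℝ) * β := (div_lt_iff₀ hβ0).1 hM1
    have hMβ' : 1 < (M : ℝ) * (1 - β) := (div_lt_iff₀ (by linarith)).1 hM2
    obtain ⟨m, hm⟩ := chain M (1 / 400) (by norm_num)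
    have hstep : ∀ n < M, m (n + 1) = m n + r := fun n hn => by
      have := step_eq_round le_rfl (hm n hn); omega
    -- the phases
    set φ : ℕ → ℝ := fun n => Int.fract (((m n : ℤ) : ℝ) * √2) with hφ
    have hd : ∀ n < M, φ (n + 1) - φ n = β ∨ φ (n + 1) - φ n = β - 1 := by
      intro n hn
      have e : ((m (n + 1) : ℤ) : ℝ) * √2 = ((m n : ℤ) : ℝ) * √2 + (r : ℝ) * √2 := by
        rw [hstep n hn]; push_cast; ring
      simp only [hφ]
      rw [e]
      exact fract_add_sub_fract _ _
    have hclose : ∀ n < M, |3 / 100 * (φ (n + 1) - φ n) - (γ - 41 / 50 * r)| ≤ 2 * (1 / 400) := by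
      intro n hn
      have h := hm n hn
      have hsub := qpHeight_sub (m n) (m (n + 1))
      have hk : ((m (n + 1) - m n : ℤ) : ℝ) = r := by rw [hstep n hn]; push_cast; ring
      rw [hk] at hsub
      rw [hsub] at h
      simp only [hφ]
      convert h using 2
      ring
    -- all increments equal the first one
    have hall : ∀ n < M, φ (n + 1) - φ n = φ 1 - φ 0 := by
      intro n hn
      have hM0 : 0 < M := lt_of_le_of_lt (Nat.zero_le n) hn
      have c1 := hclose n hn
      have c0 := hclose 0 hM0
      rw [abs_le] at c1 c0
      rcases hd n hn with h1 | h1 <;> rcases hd 0 hM0 with h2 | h2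
      · rw [h1, h2]
      · exfalso; simp only [zero_add] at h2 c0; rw [h1] at c1; rw [h2] at c0; linarith [c1.1, c1.2, c0.1, c0.2]
      · exfalso; simp only [zero_add] at h2 c0; rw [h1] at c1; rw [h2] at c0; linarith [c1.1, c1.2, c0.1, c0.2]
      · rw [h1, h2]
    -- telescope
    have htel : ∑ n ∈ Finset.range M, (φ (n + 1) - φ n) = φ M - φ 0 := Finset.sum_range_sub φ M
    have hconst : ∑ n ∈ Finset.range M, (φ (n + 1) - φ n) = M * (φ 1 - φ 0) := by
      rw [Finset.sum_congr rfl fun n hn => hall n (Finset.mem_range.1 hn), Finset.sum_const,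
        Finset.card_range, nsmul_eq_mul]
    have hφM0 := Int.fract_nonneg (((m M : ℤ) : ℝ) * √2)
    have hφM1 := Int.fract_lt_one (((m M : ℤ) : ℝ) * √2)
    have hφ00 := Int.fract_nonneg (((m 0 : ℤ) : ℝ) * √2)
    have hφ01 := Int.fract_lt_one (((m 0 : ℤ) : ℝ) * √2)
    have hrange : -1 < (M : ℝ) * (φ 1 - φ 0) ∧ (M : ℝ) * (φ 1 - φ 0) < 1 := by
      rw [← hconst, htel]; simp only [hφ]; constructor <;> linarith
    have hM0 : 0 < M := Nat.pos_of_ne_zero (by rintro rfl; norm_num at hMβ)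
    rcases hd 0 hM0 with h1 | h1
    · simp only [zero_add] at h1; rw [h1] at hrange; linarith [hrange.2]
    · simp only [zero_add] at h1; rw [h1] at hrange; nlinarith [hrange.1]


/-! ## Periodic configurations have a period with non-zero vertical component -/

/-- A full-rank lattice of `ℝ³` contains a vector with non-zero third coordinate. -/
theorem exists_mem_lattice_apply_two_ne_zero (P : PeriodicConfiguration 3) :
    ∃ g ∈ P.lattice, g 2 ≠ 0 := by
  by_contra h
  push Not at h
  have hspan : Submodule.span ℝ ((P.lattice : Submodule ℤ E3) : Set E3) = ⊤ := IsZLattice.span_top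
  have key : ∀ v ∈ Submodule.span ℝ ((P.lattice : Submodule ℤ E3) : Set E3), v 2 = 0 := by
    intro v hv
    induction hv using Submodule.span_induction with
    | mem v hv => exact h v hv
    | zero => simp
    | add u v _ _ hu hv => simp [hu, hv]
    | smul c v _ hv => simp [hv]
  have hmem : EuclideanSpace.single (2 : Fin 3) (1 : ℝ) ∈
      Submodule.span ℝ ((P.lattice : Submodule ℤ E3) : Set E3) := by
    rw [hspan]; trivial
  have := key _ hmem
  simp at this

/-! ## No periodic windows for configurations living on the quasi-periodic heights -/

/-- If every particle of every `x N` has its third coordinate among the quasi-periodic heights,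
then `x` has NO periodic windows.  Only the first matching clause (every site of `P` in the ball is
near a particle) is used. -/
theorem not_hasPeriodicWindows_of_heights (x : (N : ℕ) → (Fin N → E3))
    (hx : ∀ N (i : Fin N), ∃ m : ℤ, x N i 2 = qpHeight m) : ¬ HasPeriodicWindows x := by
  rintro ⟨P, hP⟩
  obtain ⟨g, hg, hγ⟩ := exists_mem_lattice_apply_two_ne_zero P
  obtain ⟨s₀, hs₀⟩ := P.points_nonempty
  refine no_height_chain hγ fun M ε hε => ?_
  obtain ⟨N, t, h1, -⟩ := (hP (‖s₀‖ + M * ‖g‖) ε hε).exists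
  have hpt : ∀ n : ℕ, n ≤ M → ∃ m : ℤ, |qpHeight m + t 2 - (s₀ 2 + (n : ℝ) * g 2)| ≤ ε := by
    intro n hn
    have hmem : s₀ + (n : ℝ) • g ∈ P.points := by
      refine P.add_mem_points hs₀ ?_
      rw [Nat.cast_smul_eq_nsmul]
      exact nsmul_mem hg n
    have hnorm : ‖s₀ + (n : ℝ) • g‖ ≤ ‖s₀‖ + M * ‖g‖ := by
      calc ‖s₀ + (n : ℝ) • g‖ ≤ ‖s₀‖ + ‖(n : ℝ) • g‖ := norm_add_le _ _
        _ = ‖s₀‖ + n * ‖g‖ := by rw [norm_smul, Real.norm_eq_abs, Nat.abs_cast]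
        _ ≤ ‖s₀‖ + M * ‖g‖ := by gcongr
    obtain ⟨i, hi⟩ := h1 _ hmem hnorm
    obtain ⟨m, hm⟩ := hx N i
    refine ⟨m, ?_⟩
    have h2 := (PiLp.dist_apply_le (x N i + t) (s₀ + (n : ℝ) • g) 2).trans hi
    rw [Real.dist_eq] at h2
    simpa [hm] using h2
  choose! m hm using hpt
  refine ⟨m, fun n hn => ?_⟩
  have h0 := hm n hn.le
  have h1 := hm (n + 1) hn
  rw [abs_le] at h0 h1 ⊢
  push_cast at h1
  constructor <;> linarith [h0.1, h0.2, h1.1, h1.2]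

/-! ## The enumerated layered set -/

/-- The point `(m, i, j)` of the layered set: fcc registry (`constHagg`), `a = 1`, heights
`qpHeight`; written in the exact format of the crux's layered set `S`. -/
def qpPoint (q : ℤ × ℤ × ℤ) : E3 :=
  ((q.2.1 : ℝ) • triangularVec₁ 1) + ((q.2.2 : ℝ) • triangularVec₂ 1) +
    ((haggLabel constHagg q.1 : ℝ) • barlowOffset 1) + (qpHeight q.1 • layerNormal 1)

@[simp] theorem qpPoint_apply_zero (q : ℤ × ℤ × ℤ) :
    qpPoint q 0 = q.2.1 + q.2.2 / 2 + q.1 / 2 := by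
  simp [qpPoint, triangularVec₁, triangularVec₂, barlowOffset, layerNormal]; ring

@[simp] theorem qpPoint_apply_one (q : ℤ × ℤ × ℤ) :
    qpPoint q 1 = √3 / 6 * (3 * q.2.2 + q.1) := by
  simp [qpPoint, triangularVec₁, triangularVec₂, barlowOffset, layerNormal]; ring

@[simp] theorem qpPoint_apply_two (q : ℤ × ℤ × ℤ) : qpPoint q 2 = qpHeight q.1 := by
  simp [qpPoint, triangularVec₁, triangularVec₂, barlowOffset, layerNormal]

/-- A fixed enumeration of the index set `ℤ³`. -/
def idx : ℤ × ℤ × ℤ ≃ ℕ := Denumerable.eqv _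

/-- THE WITNESS SEQUENCE: `x N` lists the first `N` points of the layered set. -/
def qpConfig (N : ℕ) (i : Fin N) : E3 := qpPoint (idx.symm i)

theorem qpConfig_apply_two (N : ℕ) (i : Fin N) : ∃ m : ℤ, qpConfig N i 2 = qpHeight m :=
  ⟨(idx.symm i).1, by simp [qpConfig]⟩

/-- Only finitely many points of the layered set lie in a ball. -/
theorem finite_setOf_norm_qpPoint_le (R : ℝ) : {q : ℤ × ℤ × ℤ | ‖qpPoint q‖ ≤ R}.Finite := by
  set K : ℤ := ⌈7 * R + 2⌉ with hK
  refine ((Set.finite_Icc (-K) K).prod ((Set.finite_Icc (-K) K).prod (Set.finite_Icc (-K) K))).subset ?_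
  rintro ⟨m, i, j⟩ hq
  simp only [Set.mem_setOf_eq] at hq
  have hR : 0 ≤ R := (norm_nonneg _).trans hq
  have h2 : |qpHeight m| ≤ R := by
    have := (PiLp.norm_apply_le (qpPoint (m, i, j)) 2).trans hq
    simpa using this
  have h1 : √3 / 6 * |3 * (j : ℝ) + m| ≤ R := by
    have := (PiLp.norm_apply_le (qpPoint (m, i, j)) 1).trans hq
    rw [qpPoint_apply_one, Real.norm_eq_abs, abs_mul,
      abs_of_pos (by positivity : (0 : ℝ) < √3 / 6)] at this
    exact this
  have h0 : |(i : ℝ) + j / 2 + m / 2| ≤ R := by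
    have := (PiLp.norm_apply_le (qpPoint (m, i, j)) 0).trans hq
    simpa using this
  have hm : |(m : ℝ)| ≤ 2 * R + 1 := by
    unfold qpHeight at h2
    have hf0 := Int.fract_nonneg ((m : ℝ) * √2)
    have hf1 := Int.fract_lt_one ((m : ℝ) * √2)
    rw [abs_le] at h2 ⊢
    constructor <;> linarith [h2.1, h2.2]
  have hs : (1 : ℝ) ≤ √3 := by
    have h := Real.sqrt_le_sqrt (show (1 : ℝ) ≤ 3 by norm_num)
    rwa [Real.sqrt_one] at h
  have hj : |(j : ℝ)| ≤ 4 * R + 1 := by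
    have h3 : |3 * (j : ℝ) + m| ≤ 6 * R := by
      have : 1 / 6 * |3 * (j : ℝ) + m| ≤ √3 / 6 * |3 * (j : ℝ) + m| :=
        mul_le_mul_of_nonneg_right (by linarith) (abs_nonneg _)
      linarith
    rw [abs_le] at h3 hm ⊢
    constructor <;> linarith [h3.1, h3.2, hm.1, hm.2]
  have hi : |(i : ℝ)| ≤ 7 * R + 2 := by
    rw [abs_le] at h0 hm hj ⊢
    constructor <;> linarith [h0.1, h0.2, hm.1, hm.2, hj.1, hj.2]
  have hKR : (7 * R + 2 : ℝ) ≤ K := Int.le_ceil _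
  have bound : ∀ n : ℤ, |(n : ℝ)| ≤ 7 * R + 2 → n ∈ Set.Icc (-K) K := fun n hn => by
    have h' : |(n : ℝ)| ≤ K := hn.trans hKR
    rw [abs_le] at h'
    exact ⟨by exact_mod_cast h'.1, by exact_mod_cast h'.2⟩
  exact ⟨bound m (hm.trans (by linarith)), bound i hi, bound j (hj.trans (by linarith))⟩

/-- The witness HAS layered windows (it is an admissible layered set, enumerated). -/
theorem hasLayeredWindows_qpConfig : HasLayeredWindows qpConfig := by
  refine ⟨1, by norm_num, le_rfl, fun R ε hε => Filter.Eventually.frequently ?_⟩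
  obtain ⟨B, hB⟩ := ((finite_setOf_norm_qpPoint_le R).image idx).bddAbove
  rw [Filter.eventually_atTop]
  refine ⟨B + 1, fun N hN => ⟨LinearIsometry.id, 0, constHagg, qpHeight, isHaggSeq_const,
    qpHeight_spacing, ?_⟩⟩
  constructor
  · rintro p ⟨m, i, j, rfl⟩ hp
    have hq : (m, i, j) ∈ {q : ℤ × ℤ × ℤ | ‖qpPoint q‖ ≤ R} := by
      simpa [qpPoint] using hp
    have hle : idx (m, i, j) ≤ B := hB (Set.mem_image_of_mem idx hq)
    refine ⟨⟨idx (m, i, j), by omega⟩, ?_⟩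
    simp [qpConfig, qpPoint, hε.le]
  · intro i _
    refine ⟨qpConfig N i, ⟨(idx.symm i).1, (idx.symm i).2.1, (idx.symm i).2.2, ?_⟩, by simp [hε.le]⟩
    simp [qpConfig, qpPoint]

/-! ## (a) The load-bearing lemma and (a′) the zero-potential corollary -/

/-- **LOAD-BEARING (a).** Without the ground-state hypothesis the crux is false: layered windows
at every scale do NOT imply periodic windows — the free interlayer spacings of the
`LayeredWindows` format admit quasi-periodic height sequences inside the box.  Any proof of
`PeriodicGivenLayered` must use the energetics of Lennard-Jones ground states to pin the spacings
(and the stacking). -/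
theorem periodicGivenLayered_false_without_groundState : ¬ PeriodicGivenLayeredWithoutGroundState :=
  fun h => not_hasPeriodicWindows_of_heights qpConfig qpConfig_apply_two (h qpConfig hasLayeredWindows_qpConfig)

theorem qpPoint_injective : Function.Injective qpPoint := by
  rintro ⟨m, i, j⟩ ⟨m', i', j'⟩ h
  have h2 := congrArg (fun v : E3 => v 2) h
  have h1 := congrArg (fun v : E3 => v 1) h
  have h0 := congrArg (fun v : E3 => v 0) h
  simp only [qpPoint_apply_two, qpPoint_apply_one, qpPoint_apply_zero] at h2 h1 h0
  have hm : m = m' := qpHeight_strictMono.injective h2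
  subst hm
  have hs : (0 : ℝ) < √3 := by positivity
  have hj : (j : ℝ) = j' := by
    have := mul_left_cancel₀ (by positivity : (√3 / 6 : ℝ) ≠ 0) h1
    linarith
  have hj' : j = j' := by exact_mod_cast hj
  subst hj'
  have hi : (i : ℝ) = i' := by linarith
  have hi' : i = i' := by exact_mod_cast hi
  subst hi'
  rfl

theorem qpConfig_injective (N : ℕ) : Function.Injective (qpConfig N) := fun i j h =>
  Fin.ext (by simpa using congrArg idx (qpPoint_injective h))

/-- **(a′) No potential-uniform proof.** For the zero potential every injective configuration is a
ground state (`isGroundState_zero`), so the witness refutes `PeriodicGivenLayeredFor 0`; compare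
`not_isCrystallizing_zero` in the Literature file. -/
theorem not_periodicGivenLayeredFor_zero : ¬ PeriodicGivenLayeredFor (fun _ => 0) := fun h =>
  not_hasPeriodicWindows_of_heights qpConfig qpConfig_apply_two
    (h qpConfig (fun N => isGroundState_zero (qpConfig_injective N)) hasLayeredWindows_qpConfig)


/-! ## (a″) Stacking freedom at CONSTANT spacing: a Sturmian Hägg word

Second, independent load-bearing freedom: even with the scale fixed (`a = 1`), the isometry fixed
(`A = id`) and the interlayer spacing CONSTANT (`4/5`, inside the box), the free Hägg word of the
`LayeredWindows` format defeats periodic windows: take the mechanical (Sturmian) word of slope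
`α = √2 − 1`, `s m = 2(⌊(m+1)α⌋ − ⌊mα⌋) − 1`.  A period `g` with `g₃ > 0` forces, inside one window, a
chain `q₀, …, q_M` of layered points with `q_{n+1} − q_n = g ± 2ε`; heights pin the layer step to
`k = round(g₃/(4/5)) ≥ 1`; the second coordinate `(√3/6)(3Δj + ΔL)` pins `3Δj_n + W_n` to a constant,
where `W_n = haggWindow s (m₀ + nk) k = 2C_n − k` and `C_n = ⌊(m₀+(n+1)k)α⌋ − ⌊(m₀+nk)α⌋ ∈ {⌊kα⌋, ⌊kα⌋+1}`;
so `3 ∣ 2(C_n − C_0)`, `C_n = C_0`, and telescoping gives `|M·C_0 − M·kα| < 1`, impossible for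
`M > 1/fract(kα), 1/(1 − fract(kα))` (`kα` irrational).  MESSAGE TO PROVERS: pinning the spacings is not
enough — the stacking word must be controlled (zero fault density / Hägg domination is load-bearing);
a balanced aperiodic word (syndetic faults, kill criterion (iv)) is exactly what defeats the conclusion. -/

/-- The Sturmian slope `α = √2 − 1 ∈ (0, 1)`. -/
def slope : ℝ := √2 - 1

theorem slope_pos : 0 < slope := by
  have : (1 : ℝ) < √2 := by
    rw [show (1 : ℝ) = √1 by simp]
    exact Real.sqrt_lt_sqrt (by norm_num) (by norm_num)
  unfold slope; linarith

theorem slope_lt_one : slope < 1 := by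
  have : √2 < (2 : ℝ) := by
    rw [show (2 : ℝ) = √4 by rw [show (4 : ℝ) = 2 ^ 2 by norm_num, Real.sqrt_sq (by norm_num)]]
    exact Real.sqrt_lt_sqrt (by norm_num) (by norm_num)
  unfold slope; linarith

theorem irrational_slope : Irrational slope := by
  have h := irrational_sqrt_two.sub_natCast 1
  simpa [slope] using h

/-- `⌊x + y⌋ − ⌊x⌋ ∈ {⌊y⌋, ⌊y⌋ + 1}`. -/
theorem floor_add_sub_floor (x y : ℝ) : ⌊x + y⌋ - ⌊x⌋ = ⌊y⌋ ∨ ⌊x + y⌋ - ⌊x⌋ = ⌊y⌋ + 1 := by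
  have h1 := Int.floor_le x; have h2 := Int.lt_floor_add_one x
  have h3 := Int.floor_le y; have h4 := Int.lt_floor_add_one y
  have h5 : ⌊x⌋ + ⌊y⌋ ≤ ⌊x + y⌋ := Int.le_floor.2 (by push_cast; linarith)
  have h6 : ⌊x + y⌋ < ⌊x⌋ + ⌊y⌋ + 2 := Int.floor_lt.2 (by push_cast; linarith)
  omega

/-- The mechanical coding `c m = ⌊(m+1)α⌋ − ⌊mα⌋ ∈ {0, 1}`. -/
def sturmC (m : ℤ) : ℤ := ⌊((m : ℝ) + 1) * slope⌋ - ⌊(m : ℝ) * slope⌋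

theorem sturmC_mem (m : ℤ) : sturmC m = 0 ∨ sturmC m = 1 := by
  have h := floor_add_sub_floor ((m : ℝ) * slope) slope
  have h0 : ⌊slope⌋ = 0 := Int.floor_eq_zero_iff.2 ⟨slope_pos.le, slope_lt_one⟩
  rw [h0, ← add_one_mul] at h
  simpa [sturmC] using h

/-- The Sturmian Hägg word `s = 2c − 1`. -/
def sturm (m : ℤ) : ℤ := 2 * sturmC m - 1

theorem isHaggSeq_sturm : IsHaggSeq sturm := fun m => by
  rcases sturmC_mem m with h | h
  · right; simp [sturm, h]
  · left; simp [sturm, h]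

/-- Block sums of the coding telescope. -/
theorem sum_sturmC (m : ℤ) (k : ℕ) :
    ∑ i ∈ Finset.range k, sturmC (m + i) = ⌊((m + k : ℤ) : ℝ) * slope⌋ - ⌊(m : ℝ) * slope⌋ := by
  induction k with
  | zero => simp
  | succ k ih =>
    rw [Finset.sum_range_succ, ih]
    unfold sturmC
    have e1 : (((m + (k : ℕ) : ℤ) : ℝ) + 1) = ((m + ((k + 1 : ℕ) : ℤ) : ℤ) : ℝ) := by push_cast; ring
    have e2 : (((m + (k : ℕ) : ℤ) : ℝ)) = ((m + (k : ℤ) : ℤ) : ℝ) := by push_cast; ring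
    rw [e1, e2]; push_cast; ring

/-- Windows of the Sturmian word: `haggWindow s m k = 2(⌊(m+k)α⌋ − ⌊mα⌋) − k`. -/
theorem haggWindow_sturm (m : ℤ) (k : ℕ) :
    haggWindow sturm m k = 2 * (⌊((m + k : ℤ) : ℝ) * slope⌋ - ⌊(m : ℝ) * slope⌋) - k := by
  unfold haggWindow
  simp only [sturm]
  rw [Finset.sum_sub_distrib, ← Finset.mul_sum, sum_sturmC]
  simp

/-- `|haggLabel s m| ≤ |m|` for a `±1` word (same statement as
`…LayeredGluing01.abs_haggLabel_le`, re-proved to keep imports light). -/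
theorem abs_haggLabel_le' {s : ℤ → ℤ} (hs : IsHaggSeq s) (m : ℤ) : |haggLabel s m| ≤ |m| := by
  induction m using Int.induction_on with
  | zero => simp
  | succ n ih =>
    rw [haggLabel_succ]
    rw [Nat.abs_cast] at ih
    rw [show |(n : ℤ) + 1| = n + 1 by rw [abs_of_nonneg (by positivity)]]
    rcases hs n with h | h <;> rw [h] <;>
      cases abs_le.1 ih <;> [apply abs_le.2; apply abs_le.2] <;> constructor <;> linarith
  | pred n ih =>
    have h1 := haggLabel_succ s (-(n : ℤ) - 1)
    rw [show -(n : ℤ) - 1 + 1 = -n by ring] at h1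
    rw [abs_neg, Nat.abs_cast] at ih
    rw [show |-(n : ℤ) - 1| = n + 1 by
      rw [show -(n : ℤ) - 1 = -(n + 1) by ring, abs_neg, abs_of_nonneg (by positivity)]]
    rw [h1] at ih
    rcases hs (-(n : ℤ) - 1) with h | h <;> rw [h] at ih <;>
      cases abs_le.1 ih <;> apply abs_le.2 <;> constructor <;> linarith

/-- The point `(m, i, j)` of the Sturmian stacking at constant spacing `4/5`, `a = 1`, in the exact
format of the crux's layered set (`z m = 4/5·m`). -/
def stPoint (q : ℤ × ℤ × ℤ) : E3 :=
  ((q.2.1 : ℝ) • triangularVec₁ 1) + ((q.2.2 : ℝ) • triangularVec₂ 1) +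
    ((haggLabel sturm q.1 : ℝ) • barlowOffset 1) + ((fun m : ℤ => 4 / 5 * (m : ℝ)) q.1 • layerNormal 1)

@[simp] theorem stPoint_apply_zero (q : ℤ × ℤ × ℤ) :
    stPoint q 0 = q.2.1 + q.2.2 / 2 + haggLabel sturm q.1 / 2 := by
  simp [stPoint, triangularVec₁, triangularVec₂, barlowOffset, layerNormal]; ring

@[simp] theorem stPoint_apply_one (q : ℤ × ℤ × ℤ) :
    stPoint q 1 = √3 / 6 * (3 * q.2.2 + haggLabel sturm q.1) := by
  simp [stPoint, triangularVec₁, triangularVec₂, barlowOffset, layerNormal]; ring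

@[simp] theorem stPoint_apply_two (q : ℤ × ℤ × ℤ) : stPoint q 2 = 4 / 5 * q.1 := by
  simp [stPoint, triangularVec₁, triangularVec₂, barlowOffset, layerNormal]

/-- THE SECOND WITNESS SEQUENCE. -/
def stConfig (N : ℕ) (i : Fin N) : E3 := stPoint (idx.symm i)

/-- ROUNDING at spacing `4/5`. -/
theorem step_eq_round' {γ ε : ℝ} (hε : ε ≤ 1 / 10) {m m' : ℤ}
    (h : |4 / 5 * (m' : ℝ) - 4 / 5 * m - γ| ≤ 2 * ε) : m' - m = round (γ / (4 / 5)) := by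
  have hρb : |γ / (4 / 5) - round (γ / (4 / 5))| ≤ 1 / 2 := abs_sub_round _
  set ρ : ℤ := round (γ / (4 / 5)) with hρ
  rw [show γ / (4 / 5) = 5 / 4 * γ by ring] at hρb; rw [abs_le] at h hρb
  have hlt : |((m' - m : ℤ) : ℝ) - ρ| < 1 := by
    push_cast; rw [abs_lt]; constructor <;> linarith [h.1, h.2, hρb.1, hρb.2]
  rw [abs_lt] at hlt
  have h5 : m' - m - ρ < 1 := by exact_mod_cast (show (((m' - m : ℤ) : ℝ) - ρ) < 1 from hlt.2)
  have h6 : -1 < m' - m - ρ := by exact_mod_cast (show (-1 : ℝ) < ((m' - m : ℤ) : ℝ) - ρ from hlt.1)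
  omega

/-- NUMBER THEORY CORE (stacking): no vector `g` with `g₃ > 0` admits, for every `M` and `ε > 0`, a
chain of `M + 1` Sturmian-stacking points with consecutive differences within `2ε` of `g`. -/
theorem no_sturm_chain {g : E3} (hγ : 0 < g 2)
    (chain : ∀ (M : ℕ) (ε : ℝ), 0 < ε →
      ∃ q : ℕ → ℤ × ℤ × ℤ, ∀ n < M, ‖stPoint (q (n + 1)) - stPoint (q n) - g‖ ≤ 2 * ε) : False := by
  -- coordinates of a chain step
  have c2 : ∀ (q q' : ℤ × ℤ × ℤ) (ε : ℝ), ‖stPoint q' - stPoint q - g‖ ≤ 2 * ε →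
      |4 / 5 * (q'.1 : ℝ) - 4 / 5 * q.1 - g 2| ≤ 2 * ε := fun q q' ε h => by
    have := (PiLp.norm_apply_le (stPoint q' - stPoint q - g) 2).trans h
    simpa [Real.norm_eq_abs] using this
  have c1 : ∀ (q q' : ℤ × ℤ × ℤ) (ε : ℝ), ‖stPoint q' - stPoint q - g‖ ≤ 2 * ε →
      |√3 / 6 * ((3 * (q'.2.2 - q.2.2) + (haggLabel sturm q'.1 - haggLabel sturm q.1) : ℤ) : ℝ) - g 1|
        ≤ 2 * ε := fun q q' ε h => by
    have := (PiLp.norm_apply_le (stPoint q' - stPoint q - g) 1).trans h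
    have e : (stPoint q' - stPoint q - g) 1 = √3 / 6 * ((3 * (q'.2.2 - q.2.2) +
        (haggLabel sturm q'.1 - haggLabel sturm q.1) : ℤ) : ℝ) - g 1 := by
      rw [PiLp.sub_apply, PiLp.sub_apply, stPoint_apply_one, stPoint_apply_one]; push_cast; ring
    rw [e, Real.norm_eq_abs] at this
    exact this
  set k : ℤ := round (g 2 / (4 / 5)) with hk
  by_cases hk0 : k = 0
  · obtain ⟨q, hq⟩ := chain 1 (min (1 / 10) (g 2 / 4)) (lt_min (by norm_num) (by linarith))
    have h := c2 _ _ _ (hq 0 zero_lt_one)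
    have hs := step_eq_round' (min_le_left _ _) h
    rw [← hk, hk0] at hs
    have : ((q (0 + 1)).1 : ℝ) = (q 0).1 := by exact_mod_cast (show (q (0 + 1)).1 = (q 0).1 by omega)
    rw [this, sub_self, zero_sub, abs_neg, abs_of_pos hγ] at h
    linarith [min_le_right (1 / 10 : ℝ) (g 2 / 4)]
  · -- k ≥ 1
    have hk1 : 0 ≤ k := by
      rw [hk, round_eq]; exact Int.floor_nonneg.2 (by positivity)
    obtain ⟨K, hK⟩ : ∃ K : ℕ, (K : ℤ) = k := ⟨k.toNat, Int.toNat_of_nonneg hk1⟩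
    set θ : ℝ := Int.fract ((k : ℝ) * slope) with hθ
    have hθ0 : 0 < θ := by
      rcases (Int.fract_nonneg ((k : ℝ) * slope)).lt_or_eq with h | h
      · exact h
      · exfalso
        have hirr : Irrational ((k : ℝ) * slope) := irrational_slope.intCast_mul hk0
        apply hirr.ne_int ⌊(k : ℝ) * slope⌋
        have := Int.fract_add_floor ((k : ℝ) * slope)
        rw [← hθ] at this; rw [← hθ] at h
        linarith
    have hθ1 : θ < 1 := Int.fract_lt_one _
    obtain ⟨M, hM⟩ := exists_nat_gt (max (1 / θ) (1 / (1 - θ)))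
    have hMθ : 1 < (M : ℝ) * θ := (div_lt_iff₀ hθ0).1 ((le_max_left _ _).trans_lt hM)
    have hMθ' : 1 < (M : ℝ) * (1 - θ) := (div_lt_iff₀ (by linarith)).1 ((le_max_right _ _).trans_lt hM)
    have hM0 : 0 < M := Nat.pos_of_ne_zero (by rintro rfl; norm_num at hMθ)
    obtain ⟨q, hq⟩ := chain M (1 / 100) (by norm_num)
    -- layer steps
    have hstep : ∀ n < M, (q (n + 1)).1 = (q n).1 + k := fun n hn => by
      have := step_eq_round' (by norm_num) (c2 _ _ _ (hq n hn)); omega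
    have hlayer : ∀ n ≤ M, (q n).1 = (q 0).1 + n * k := by
      intro n hn
      induction n with
      | zero => simp
      | succ n ih => rw [hstep n (by omega), ih (by omega)]; push_cast; ring
    -- the lateral integer D n
    set D : ℕ → ℤ := fun n => 3 * ((q (n + 1)).2.2 - (q n).2.2) +
      (haggLabel sturm (q (n + 1)).1 - haggLabel sturm (q n).1) with hD
    have hDconst : ∀ n < M, D n = D 0 := by
      intro n hn
      have a1 := c1 _ _ _ (hq n hn)
      have a0 := c1 _ _ _ (hq 0 hM0)
      have hs : (1 : ℝ) ≤ √3 := by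
        have h := Real.sqrt_le_sqrt (show (1 : ℝ) ≤ 3 by norm_num)
        rwa [Real.sqrt_one] at h
      have hdiff : √3 / 6 * |((D n : ℤ) : ℝ) - D 0| ≤ 4 * (1 / 100) := by
        rw [← abs_of_pos (by positivity : (0 : ℝ) < √3 / 6), ← abs_mul]
        rw [abs_le] at a1 a0 ⊢
        simp only [hD]
        constructor <;> nlinarith [a1.1, a1.2, a0.1, a0.2]
      have h1 : |((D n : ℤ) : ℝ) - D 0| < 1 := by
        have : 1 / 6 * |((D n : ℤ) : ℝ) - D 0| ≤ √3 / 6 * |((D n : ℤ) : ℝ) - D 0| :=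
          mul_le_mul_of_nonneg_right (by linarith) (abs_nonneg _)
        linarith
      rw [abs_lt] at h1
      have h5 : D n - D 0 < 1 := by exact_mod_cast (show ((D n : ℤ) : ℝ) - D 0 < 1 from h1.2)
      have h6 : -1 < D n - D 0 := by exact_mod_cast (show (-1 : ℝ) < ((D n : ℤ) : ℝ) - D 0 from h1.1)
      omega
    -- the block counts C n
    set C : ℕ → ℤ := fun n => ⌊(((q 0).1 + ((n + 1 : ℕ) : ℤ) * k : ℤ) : ℝ) * slope⌋ -
      ⌊(((q 0).1 + (n : ℤ) * k : ℤ) : ℝ) * slope⌋ with hC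
    have hW : ∀ n < M, haggLabel sturm (q (n + 1)).1 - haggLabel sturm (q n).1 = 2 * C n - k := by
      intro n hn
      simp only [hC]
      rw [hstep n hn, hlayer n hn.le, ← hK, haggLabel_add_natCast, haggWindow_sturm]
      push_cast; ring_nf
    have hCmem : ∀ n, C n = ⌊(k : ℝ) * slope⌋ ∨ C n = ⌊(k : ℝ) * slope⌋ + 1 := by
      intro n
      have := floor_add_sub_floor ((((q 0).1 + (n : ℤ) * k : ℤ) : ℝ) * slope) ((k : ℝ) * slope)
      have e : (((q 0).1 + (n : ℤ) * k : ℤ) : ℝ) * slope + (k : ℝ) * slope =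
          (((q 0).1 + ((n + 1 : ℕ) : ℤ) * k : ℤ) : ℝ) * slope := by push_cast; ring
      rw [e] at this
      simpa [hC] using this
    have hCconst : ∀ n < M, C n = C 0 := by
      intro n hn
      have h := hDconst n hn
      simp only [hD] at h
      rw [hW n hn, hW 0 hM0] at h
      rcases hCmem n with h1 | h1 <;> rcases hCmem 0 with h2 | h2 <;> omega
    -- telescope the counts
    have htel : ∑ n ∈ Finset.range M, C n =
        ⌊(((q 0).1 + ((M : ℕ) : ℤ) * k : ℤ) : ℝ) * slope⌋ - ⌊(((q 0).1 + ((0 : ℕ) : ℤ) * k : ℤ) : ℝ) * slope⌋ := by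
      simp only [hC]
      exact Finset.sum_range_sub (fun n : ℕ => ⌊(((q 0).1 + ((n : ℕ) : ℤ) * k : ℤ) : ℝ) * slope⌋) M
    have hsum : ∑ n ∈ Finset.range M, C n = M * C 0 := by
      rw [Finset.sum_congr rfl fun n hn => hCconst n (Finset.mem_range.1 hn), Finset.sum_const,
        Finset.card_range, nsmul_eq_mul]
    -- floor bounds: the telescoped difference is within 1 of M k α
    have hb1 := Int.floor_le ((((q 0).1 + ((M : ℕ) : ℤ) * k : ℤ) : ℝ) * slope)
    have hb2 := Int.lt_floor_add_one ((((q 0).1 + ((M : ℕ) : ℤ) * k : ℤ) : ℝ) * slope)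
    have hb3 := Int.floor_le ((((q 0).1 + ((0 : ℕ) : ℤ) * k : ℤ) : ℝ) * slope)
    have hb4 := Int.lt_floor_add_one ((((q 0).1 + ((0 : ℕ) : ℤ) * k : ℤ) : ℝ) * slope)
    have hkey : |((M * C 0 : ℤ) : ℝ) - M * k * slope| < 1 := by
      rw [← hsum, htel]; push_cast at hb1 hb2 hb3 hb4 ⊢
      rw [abs_lt]; constructor <;> nlinarith [hb1, hb2, hb3, hb4]
    have hfl := Int.floor_le ((k : ℝ) * slope)
    have hfl' := Int.fract_add_floor ((k : ℝ) * slope)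
    rw [← hθ] at hfl'
    rw [abs_lt] at hkey; push_cast at hkey
    rcases hCmem 0 with h1 | h1
    · rw [h1] at hkey
      -- M (⌊kα⌋ − kα) = −M θ > −1
      nlinarith [hkey.1, hkey.2, hMθ]
    · rw [h1] at hkey; push_cast at hkey
      nlinarith [hkey.1, hkey.2, hMθ']


/-- If every particle of every `x N` is a point of the Sturmian stacking, `x` has NO periodic windows. -/
theorem not_hasPeriodicWindows_of_sturm (x : (N : ℕ) → (Fin N → E3))
    (hx : ∀ N (i : Fin N), ∃ q : ℤ × ℤ × ℤ, x N i = stPoint q) : ¬ HasPeriodicWindows x := by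
  rintro ⟨P, hP⟩
  obtain ⟨g, hg, hγ⟩ : ∃ g ∈ P.lattice, 0 < g 2 := by
    obtain ⟨g, hg, h⟩ := exists_mem_lattice_apply_two_ne_zero P
    rcases lt_or_gt_of_ne h with h | h
    · exact ⟨-g, neg_mem hg, by simpa using h⟩
    · exact ⟨g, hg, h⟩
  obtain ⟨s₀, hs₀⟩ := P.points_nonempty
  refine no_sturm_chain hγ fun M ε hε => ?_
  obtain ⟨N, t, h1, -⟩ := (hP (‖s₀‖ + M * ‖g‖) ε hε).exists
  have hpt : ∀ n : ℕ, n ≤ M → ∃ q : ℤ × ℤ × ℤ, ‖stPoint q + t - (s₀ + (n : ℝ) • g)‖ ≤ ε := by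
    intro n hn
    have hmem : s₀ + (n : ℝ) • g ∈ P.points := by
      refine P.add_mem_points hs₀ ?_
      rw [Nat.cast_smul_eq_nsmul]
      exact nsmul_mem hg n
    have hnorm : ‖s₀ + (n : ℝ) • g‖ ≤ ‖s₀‖ + M * ‖g‖ := by
      calc ‖s₀ + (n : ℝ) • g‖ ≤ ‖s₀‖ + ‖(n : ℝ) • g‖ := norm_add_le _ _
        _ = ‖s₀‖ + n * ‖g‖ := by rw [norm_smul, Real.norm_eq_abs, Nat.abs_cast]
        _ ≤ ‖s₀‖ + M * ‖g‖ := by gcongr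
    obtain ⟨i, hi⟩ := h1 _ hmem hnorm
    obtain ⟨q, hq⟩ := hx N i
    exact ⟨q, by rw [← hq, ← dist_eq_norm]; exact hi⟩
  choose! q hq using hpt
  refine ⟨q, fun n hn => ?_⟩
  have h0 := hq n hn.le
  have h1 := hq (n + 1) hn
  have e : stPoint (q (n + 1)) - stPoint (q n) - g =
      (stPoint (q (n + 1)) + t - (s₀ + ((n + 1 : ℕ) : ℝ) • g)) - (stPoint (q n) + t - (s₀ + (n : ℝ) • g)) := by
    push_cast; rw [add_smul, one_smul]; abel
  rw [e]
  exact (norm_sub_le _ _).trans (by linarith)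

/-- Only finitely many points of the Sturmian stacking lie in a ball. -/
theorem finite_setOf_norm_stPoint_le (R : ℝ) : {q : ℤ × ℤ × ℤ | ‖stPoint q‖ ≤ R}.Finite := by
  set K : ℤ := ⌈7 * R + 2⌉ with hK
  refine ((Set.finite_Icc (-K) K).prod ((Set.finite_Icc (-K) K).prod (Set.finite_Icc (-K) K))).subset ?_
  rintro ⟨m, i, j⟩ hq
  simp only [Set.mem_setOf_eq] at hq
  have hR : 0 ≤ R := (norm_nonneg _).trans hq
  have h2 : 4 / 5 * |(m : ℝ)| ≤ R := by
    have := (PiLp.norm_apply_le (stPoint (m, i, j)) 2).trans hq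
    simpa using this
  have h1 : √3 / 6 * |3 * (j : ℝ) + haggLabel sturm m| ≤ R := by
    have := (PiLp.norm_apply_le (stPoint (m, i, j)) 1).trans hq
    rw [stPoint_apply_one, Real.norm_eq_abs, abs_mul,
      abs_of_pos (by positivity : (0 : ℝ) < √3 / 6)] at this
    exact this
  have h0 : |(i : ℝ) + j / 2 + haggLabel sturm m / 2| ≤ R := by
    have := (PiLp.norm_apply_le (stPoint (m, i, j)) 0).trans hq
    simpa using this
  have hL : |(haggLabel sturm m : ℝ)| ≤ |(m : ℝ)| := by
    rw [← Int.cast_abs, ← Int.cast_abs]; exact_mod_cast abs_haggLabel_le' isHaggSeq_sturm m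
  have hm : |(m : ℝ)| ≤ 2 * R := by linarith
  have hL' : |(haggLabel sturm m : ℝ)| ≤ 2 * R := hL.trans hm
  have hs : (1 : ℝ) ≤ √3 := by
    have h := Real.sqrt_le_sqrt (show (1 : ℝ) ≤ 3 by norm_num)
    rwa [Real.sqrt_one] at h
  have hj : |(j : ℝ)| ≤ 4 * R := by
    have h3 : |3 * (j : ℝ) + haggLabel sturm m| ≤ 6 * R := by
      have : 1 / 6 * |3 * (j : ℝ) + haggLabel sturm m| ≤ √3 / 6 * |3 * (j : ℝ) + haggLabel sturm m| :=
        mul_le_mul_of_nonneg_right (by linarith) (abs_nonneg _)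
      linarith
    rw [abs_le] at h3 hL' ⊢
    constructor <;> linarith [h3.1, h3.2, hL'.1, hL'.2]
  have hi : |(i : ℝ)| ≤ 7 * R := by
    rw [abs_le] at h0 hj hL' ⊢
    constructor <;> linarith [h0.1, h0.2, hj.1, hj.2, hL'.1, hL'.2]
  have hKR : (7 * R + 2 : ℝ) ≤ K := Int.le_ceil _
  have bound : ∀ n : ℤ, |(n : ℝ)| ≤ 7 * R + 2 → n ∈ Set.Icc (-K) K := fun n hn => by
    have h' : |(n : ℝ)| ≤ K := hn.trans hKR
    rw [abs_le] at h'
    exact ⟨by exact_mod_cast h'.1, by exact_mod_cast h'.2⟩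
  exact ⟨bound m (hm.trans (by linarith)), bound i (hi.trans (by linarith)), bound j (hj.trans (by linarith))⟩

/-- CONSTANT-SPACING LAYERED WINDOWS: the layered-window hypothesis of the crux specialised to `a = 1`,
`A = id` and constant interlayer spacing `4/5` (inside the box `[39/50, 17/20]`); only the Hägg word
and the translation remain free. -/
def HasConstSpacingLayeredWindows (x : (N : ℕ) → (Fin N → E3)) : Prop :=
  ∀ R ε : ℝ, 0 < ε → ∃ᶠ N in Filter.atTop, ∃ (t : EuclideanSpace ℝ (Fin 3)) (s : ℤ → ℤ), IsHaggSeq s ∧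
    let S : Set (EuclideanSpace ℝ (Fin 3)) := {p | ∃ m i j : ℤ, p = ((i : ℝ) • triangularVec₁ 1) +
      ((j : ℝ) • triangularVec₂ 1) + ((haggLabel s m : ℝ) • barlowOffset 1) +
      ((fun m : ℤ => 4 / 5 * (m : ℝ)) m • layerNormal 1)};
    (∀ p ∈ S, ‖p‖ ≤ R → ∃ i : Fin N, dist (x N i + t) p ≤ ε) ∧
    (∀ i : Fin N, ‖x N i + t‖ ≤ R → ∃ p ∈ S, dist (x N i + t) p ≤ ε)

/-- Constant-spacing layered windows are layered windows. -/
theorem HasConstSpacingLayeredWindows.hasLayeredWindows {x : (N : ℕ) → (Fin N → E3)}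
    (h : HasConstSpacingLayeredWindows x) : HasLayeredWindows x := by
  refine ⟨1, by norm_num, le_rfl, fun R ε hε => ?_⟩
  refine (h R ε hε).mono fun N hN => ?_
  obtain ⟨t, s, hs, h1, h2⟩ := hN
  refine ⟨LinearIsometry.id, t, s, fun m : ℤ => 4 / 5 * (m : ℝ), hs, fun m => ?_, ?_⟩
  · push_cast; constructor <;> linarith
  · simpa using And.intro h1 h2

/-- The crux WITHOUT the ground-state hypothesis and WITH the layered hypothesis strengthened to constant
spacing (weaker than `PeriodicGivenLayeredWithoutGroundState`). -/
def PeriodicGivenConstSpacingLayeredWithoutGroundState : Prop :=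
  ∀ x : (N : ℕ) → (Fin N → E3), HasConstSpacingLayeredWindows x → HasPeriodicWindows x

theorem periodicGivenConstSpacing_of_without (h : PeriodicGivenLayeredWithoutGroundState) :
    PeriodicGivenConstSpacingLayeredWithoutGroundState := fun x hx => h x hx.hasLayeredWindows

/-- The Sturmian witness HAS constant-spacing layered windows. -/
theorem hasConstSpacingLayeredWindows_stConfig : HasConstSpacingLayeredWindows stConfig := by
  intro R ε hε
  refine Filter.Eventually.frequently ?_
  obtain ⟨B, hB⟩ := ((finite_setOf_norm_stPoint_le R).image idx).bddAbove
  rw [Filter.eventually_atTop]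
  refine ⟨B + 1, fun N hN => ⟨0, sturm, isHaggSeq_sturm, ?_⟩⟩
  constructor
  · rintro p ⟨m, i, j, rfl⟩ hp
    have hq : (m, i, j) ∈ {q : ℤ × ℤ × ℤ | ‖stPoint q‖ ≤ R} := by
      simpa [stPoint] using hp
    have hle : idx (m, i, j) ≤ B := hB (Set.mem_image_of_mem idx hq)
    refine ⟨⟨idx (m, i, j), by omega⟩, ?_⟩
    simp [stConfig, stPoint, hε.le]
  · intro i _
    refine ⟨stConfig N i, ⟨(idx.symm i).1, (idx.symm i).2.1, (idx.symm i).2.2, ?_⟩, by simp [hε.le]⟩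
    simp [stConfig, stPoint]

/-- **LOAD-BEARING (a″): the stacking word.** Even with scale, frame and interlayer spacing pinned, the
free Hägg word defeats periodic windows without energetics: a Sturmian (balanced, aperiodic,
syndetic-fault) stacking has constant-spacing layered windows at every scale but no periodic windows.
Any proof of the crux must use the Lennard-Jones energetics to control the stacking word (zero fault
density / Hägg domination is load-bearing), not only the spacings. -/
theorem periodicGivenLayered_false_without_groundState_constSpacing :
    ¬ PeriodicGivenConstSpacingLayeredWithoutGroundState := fun h =>
  not_hasPeriodicWindows_of_sturm stConfig (fun _ _ => ⟨_, rfl⟩) (h stConfig hasConstSpacingLayeredWindows_stConfig)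


/-! ## Twin crux stmt-AtomisticToContinuum-17658 (`NashClassCertificates` / `SpectralChargeLedger` copies) —
seat `refuter-cdisprove-stmt-AtomisticToContinuum-17658-0`, cycle 1 (2026-08-17): SETTLED IN TREE, no disproof exists

The two route decls named below are, after `unfold`, character for character the statement attacked in this file
(`PeriodicGivenLayeredFor lennardJones`; bridges `Iff.rfl` below), so every finding above — (a) spacing freedom,
(a′) no potential-uniform proof, (a″) stacking freedom — is about them verbatim.  The statement itself is PROVED:
`Theorems.LayeredHull.PeriodicGivenLayered_of` (twin stmt-11779, `Theorems/PhononSlackCertificatesPeriodicGivenLayered.lean`,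
2026-08-16) and, for these two copies, `Theorems.NashPeriodicGivenLayered.periodicGivenLayered_proof` /
`….spectralChargeLedger_periodicGivenLayered_proof` (`Theorems/NashClassCertificatesPeriodicGivenLayered.lean`, p157733;
item closed `proved` 2026-08-17T11:34Z @ 61c8b112ea51), axiom closure {propext, Classical.choice, Quot.sound}
(refuter crux-attack 05:42Z, strategist 10:06Z, lead 11:33Z; re-probed by this seat, `W.lean`).  Hence
`¬ PeriodicGivenLayered` is itself refutable (`fun h => h periodicGivenLayered_proof`) and no disproof — unconditional,
modulo a hypothesis, or of either twin copy — can exist short of an inconsistency of Mathlib.  The closing module is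
deliberately NOT imported here: it carries the `DedekindZeta` module cone of the proof (`GaussianLatticeSums`), and this
work file is read next to the cone-clean route files.

ANATOMY OF THE LANDED PROOF AGAINST THE LOAD-BEARING MAP (why each witness family of this file dies for genuine
Lennard-Jones ground states — information for provers re-using the mechanism elsewhere):
* the ground-state hypothesis enters ONCE, through the upper window bound (U) of `LayeredHull.stub_windowBounds`
  (finite-`N` cut-and-paste: `Σ_{p∈W} e_p(S) ≤ 2·E(#W) + C·∂W` for finite `W ⊆ S`, `S` in the hull of a ground-state
  sequence), always compared with the trivial lower bound (L) `2·E(#W) − C·∂W ≤ Σ_{p∈W} e_p(S')` for a competitor `S'`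
  at EQUAL cardinality, so the unknown ground-state energies cancel and only a boundary-order slack `O(nK + K²)` on
  `n × K × K` prisms remains;
* freedom `z` (witness `qpConfig`, (a)): killed by `LayeredHull.clo_partB` (Closing6) — a recurring increment
  oscillation `η₀ > 0` costs `κ η₀² K² (n/(G+3) − 1)` (certified increment convexity `stub_convexity`, Jensen against
  the averaged increments), volume order against boundary order;
* freedom `s` (witness `stConfig`, (a″)): killed by `LayeredHull.clo_partA` (Closing3) — a recurring stacking fault
  costs `c₀ K² (n/(G+2) − 1)` (certified registry corner gap `c₀ ≤ D_a(117a/50) − D_a(17a/10)` of `stub_registry`, sign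
  and monotonicity of `D_a` on `[39a/25, ∞)`, alternating majorisation);
* the zero potential ((a′)): `c₀ = κ = 0` and (U) is empty of content — consistent with `not_periodicGivenLayeredFor_zero`;
* uniform recurrence (`stub_recurrence`: a minimal subshift of the orbit closure of `(s, Δz)`; the hull is closed under
  local limits) is what upgrades "one fault / one oscillation" to "positive density with bounded gaps `G`": the
  Sturmian word of (a″) (`sturm = 2·sturmC − 1`, slope `√2 − 1 < 1/2`, so the letter `1` is isolated) is itself
  uniformly recurrent with fault density (`s (m+1) = s m`) equal to `3 − 2√2 ≈ 0.17 > 0`, and the quasi-periodic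
  increments of (a) take exactly the two values `41/50 + 3/100·fract √2 ≈ 0.8324` and `41/50 − 3/100·(1 − fract √2)
  ≈ 0.8024`, each on a syndetic set of indices — so both witnesses are PRICED by the closing (volume-order cost), not
  missed by it.  Nothing in the proof selects hcp over other period-2 data beyond
  ALTERNATION of the Hägg word (`s (m+1) = −s m`) and constancy of the increments; the read-off `pgl_readoff` turns
  exactly that into a `PeriodicConfiguration 3` (`barlowPeriodicConfiguration`, period 2).

ATTACKS RUN THIS CYCLE (all nil; census): (1) definitional-twin check — the three route copies agree by `Iff.rfl`
(below); (2) probe of the landed closing term and its axiom closure (standard; the `ERH`/`ERH'` decls in the cone are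
`def … : Prop`, not axioms); (3) the three witness families re-read against the hypotheses of `LayeredHull.stub_closing`:
each violates precisely (U) — a would-be ground-state hull cannot carry positive-density faults or increment
oscillations — so none extends to a sequence of LJ ground states; (4) negatives index (`ledger negatives`, 22 entries)
and barrier catalogue: `Literature.Barriers.AtomisticToContinuum.ShortRangeStackingBlindness` (pair potentials
vanishing on `[2h, ∞)`, i.e. of range below the third-neighbour distance `√(8/3)`, cannot see the stacking) is the
only catalogued barrier on this step; Lennard-Jones has infinite range and `stub_registry` certifies a NON-ZERO
registry coupling with a definite corner gap `c₀` — the barrier is evaded exactly where the proof spends its certified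
numerics, and no catalogued barrier can bite a kernel-checked theorem anyway;
(5) natural strengthenings: the rigid form S⁺ (hull contains an isometric copy of a fault-free, equally spaced
stacking) is ALSO proved (strategist `StrategistSketch.lean`, from the same stubs), the hypothesis-dropped forms are
refuted above — no open strengthening is left to attack on this item.
-/

/-- The `NashClassCertificates` copy of the crux (stmt-17658) is literally `PeriodicGivenLayeredFor lennardJones`. -/
theorem periodicGivenLayeredFor_lennardJones_iff_nash :
    PeriodicGivenLayeredFor lennardJones ↔
      Summit.AtomisticToContinuum.Crystallization.Theses.NashClassCertificates.PeriodicGivenLayered :=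
  Iff.rfl

/-- The `SpectralChargeLedger` copy of the crux (stmt-17658) is literally `PeriodicGivenLayeredFor lennardJones`. -/
theorem periodicGivenLayeredFor_lennardJones_iff_spectral :
    PeriodicGivenLayeredFor lennardJones ↔
      Summit.AtomisticToContinuum.Crystallization.Theses.SpectralChargeLedger.PeriodicGivenLayered :=
  Iff.rfl

/-- The twin copies agree with the proved original (stmt-11779) definitionally. -/
theorem nash_iff_phononSlack :
    Summit.AtomisticToContinuum.Crystallization.Theses.NashClassCertificates.PeriodicGivenLayered ↔
      Summit.AtomisticToContinuum.Crystallization.Theses.PhononSlackCertificates.PeriodicGivenLayered :=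
  Iff.rfl

theorem spectral_iff_phononSlack :
    Summit.AtomisticToContinuum.Crystallization.Theses.SpectralChargeLedger.PeriodicGivenLayered ↔
      Summit.AtomisticToContinuum.Crystallization.Theses.PhononSlackCertificates.PeriodicGivenLayered :=
  Iff.rfl

/-- (a) transported: the dropped-hypothesis form — refuted above by `periodicGivenLayered_false_without_groundState` —
is STRONGER than the stmt-17658 copy, so its failure localises the ground-state hypothesis as load-bearing for this
crux exactly as for stmt-11779 (and the landed proof does use it, in `LayeredHull.stub_closing`). -/
theorem nash_periodicGivenLayered_of_without (h : PeriodicGivenLayeredWithoutGroundState) :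
    Summit.AtomisticToContinuum.Crystallization.Theses.NashClassCertificates.PeriodicGivenLayered :=
  fun x _ hx => h x hx

/-- (a″) transported: the constant-spacing, free-word form — refuted above by
`periodicGivenLayered_false_without_groundState_constSpacing` — sits between the dropped-hypothesis form and the
ground-state-restricted constant-spacing statement, which the stmt-17658 copy implies. -/
theorem nash_periodicGivenLayered_constSpacing
    (h : Summit.AtomisticToContinuum.Crystallization.Theses.NashClassCertificates.PeriodicGivenLayered)
    (x : (N : ℕ) → (Fin N → E3)) (hx : ∀ N, IsGroundState lennardJones (x N))
    (hw : HasConstSpacingLayeredWindows x) : HasPeriodicWindows x :=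
  h x hx hw.hasLayeredWindows

end Summit.AtomisticToContinuum.Crystallization.Cruxes.PeriodicGivenLayered.Disproof

end
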